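import Literature.RingTheory.CentralSimple.PositiveInvolutionRegularTrace
import Literature.NumberTheory.ComplexMultiplication.CMAlgebraPositiveInvolution
import Mathlib.RingTheory.Finiteness.Cardinality
import Mathlib.LinearAlgebra.Isomorphisms
import HarnessLib

/-!
# Positive involutions and positive-definite invariant forms on modules (Milne, *Complex Multiplication*, Ch. I §1,
# Proposition 1.37)

Topic `Literature/RingTheory/CentralSimple` (lane `lit-hodgefound`, Layer A3, sequel of
`NumberTheory/ComplexMultiplication/CMAlgebraPositiveInvolution.lean` = Prop. 1.36 / 1.39 / Cor. 1.40 of the same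
sub-section "Positive involutions and CM-algebras").  One definition with body (`HasInvariantPosDefForm`, the printed
condition (14)), everything else proved; no named fact.

Source READ: J. S. Milne, *Complex Multiplication* (course notes, v0.10, 2020), open text `paper:url-8ccc30e4daab`
(jmilne.org `CM.pdf`), Ch. I §1 p. 20 (chunk p0020 L15–L40), verbatim:

> PROPOSITION 1.37 Let `B` be a finite-dimensional `ℚ`-algebra. The following conditions on an involution `'` of
> `B` are equivalent:
> (a) `B` is semisimple and some faithful `B`-module `V` admits a positive definite symmetric `ℚ`-bilinear form
>     `( | ) : V × V → ℚ` such that `(bu|v) = (u|b'v)`, all `b ∈ B`, `u, v ∈ V`; (14)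
> (b) every `B`-module admits a positive definite symmetric `ℚ`-bilinear form satisfying (14);
> (c) `'` is positive.
> PROOF. (a)⟹(b). Every `B`-module is a direct summand of a direct sum of copies of `V` (see p. 8), and the
> restriction of a bilinear form as in (a) to a `B`-submodule is of the same type.
> (b)⟹(c). We may suppose `ℚ = ℝ`. Let `W` be a `B`-module. According to (b), there exists a positive definite
> symmetric `ℝ`-bilinear form `( | ) : W × W → ℝ` satisfying (14). Because `ℚ = ℝ`, there exists an orthonormal basis
> `e₁, …, eₙ` for `W` relative to `( | )`, and, for any `b ∈ B`, the trace of `b'b` on `W` is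
> `Σᵢ (eᵢ|b'beᵢ) = Σᵢ (beᵢ|beᵢ)`, which is `> 0` unless `b` acts as zero on `W`. When we apply this remark with
> `W = B`, we find that `Tr_{B/ℝ}(b'b) > 0` unless `b = 0`.
> (c)⟹(a). Proposition 1.36 shows that `B` is semisimple, and for `V` we can take `B` with `(u|v) = Tr_{B/ℚ}(uv')`.

(Here, p. 8: «all `k`-algebras `B`, and all `B`-modules, will be of finite dimension over `k`».)

CARRIERS: `D` a finite-dimensional `ℚ`-algebra (`[Ring D] [Algebra ℚ D] [Module.Finite ℚ D]`), `ι : D →ₗ[ℚ] D` with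
`IsAntiInvolution D ι` (Milne's «involution»: `(ab)' = b'a'`, `a'' = a`), «positive» = the tree's
`IsPositiveAntiInvolution D ι` (`0 < Tr_{D/ℚ}(x'x)` for `x ≠ 0`, `AlbertTypes.lean`); a «`B`-module» is a `ℚ`-vector
space `W` with `[Module D W] [IsScalarTower ℚ D W] [Module.Finite ℚ W]`, «faithful» = Mathlib `FaithfulSMul D W`;
condition (14) = `HasInvariantPosDefForm ι W` below.

## What is proved

* `HasInvariantPosDefForm.pi`, `HasInvariantPosDefForm.comap` — forms as in (14) pass to finite direct sums and to
  `B`-submodules («the restriction of a bilinear form as in (a) to a `B`-submodule is of the same type»).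
* `exists_injective_linearMap_pi_of_faithfulSMul` — `B ↪ Vᵐ`, `b ↦ (b vₖ)ₖ`, for a faithful `V` with `ℚ`-basis
  `(vₖ)`; `exists_injective_linearMap_pi_of_isSemisimpleRing` — every finitely generated module over a semisimple
  `B` embeds in some `Bᵐ` («every `B`-module is a direct summand of a direct sum of copies of …», here of `B`).
* **(a) ⟹ (c)** `IsAntiInvolution.isPositiveAntiInvolution_of_hasInvariantPosDefForm` — for ANY faithful `V` with a
  form (14) the involution is positive (the printed orthonormal-basis computation, over `ℚ` with an orthogonal
  basis: `Tr_{B/ℚ}(L_{b'b}) = Σᵢ (b eᵢ | b eᵢ)/(eᵢ|eᵢ) > 0`, the tree's `trace_eq_sum_div_of_isOrthoᵢ`), the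
  semisimplicity hypothesis of (a) being then automatic (Prop. 1.36); the case `V = B`:
  `IsAntiInvolution.isPositiveAntiInvolution_of_hasInvariantPosDefForm_self`.
* **(c) ⟹ (a)** `IsPositiveAntiInvolution.hasInvariantPosDefForm_self` (with `IsPositiveAntiInvolution.isSemisimpleRing`
  of the sequel file = Prop. 1.36): `V = B` with the form `(u|v) = Tr_{B/ℚ}(u'v) + Tr_{B/ℚ}(v'u)`.
* **(c) ⟹ (b)** `IsPositiveAntiInvolution.hasInvariantPosDefForm` — EVERY (finite-dimensional) `B`-module admits a
  form (14): embed `W ↪ Bᵐ` (complement of the kernel of `Bᵐ ↠ W`, `B` being semisimple) and restrict `⊕ (u|v)`.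
* **PROP. 1.37** as equivalences: `IsAntiInvolution.isPositiveAntiInvolution_iff_hasInvariantPosDefForm_self`
  ((c) ⟺ (a) with `V = B`), `IsAntiInvolution.isPositiveAntiInvolution_iff_forall_hasInvariantPosDefForm`
  ((c) ⟺ (b)), `IsAntiInvolution.isPositiveAntiInvolution_iff_exists_faithful` ((c) ⟺ (a)).

Deviations from print: (i) in (c) ⟹ (a) the witness form is the SYMMETRISED `Tr(u'v) + Tr(v'u)` instead of
`Tr(uv')` (whose symmetry needs `Tr ∘ ' = Tr`); (ii) (a) ⟹ (b) ⟹ (c) is routed as (a) ⟹ (c) directly through the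
embedding `B ↪ Vᵐ`, `b ↦ (b vₖ)ₖ` (no semisimplicity needed), and (c) ⟹ (b) through `W ↪ Bᵐ`; (iii) «`ℚ = ℝ`,
orthonormal basis» is replaced by an orthogonal basis over `ℚ` (Mathlib `LinearMap.BilinForm.exists_orthogonal_basis`),
as already done in the tree's `PositiveInvolutionRegularTrace.lean` (Lange Lemma 2.6.1), whose trace formula is reused.

## References

* [MilneCM2006] J. S. Milne, *Complex Multiplication* (course notes; v0.10 July 14 2020), Ch. I §1 Prop. 1.37 (p. 20),
  with Prop. 1.36 and p. 8 (modules over semisimple algebras).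
* [Lange2023AbelianVarietiesComplex] H. Lange, Abelian Varieties over the Complex Numbers (2023), §2.6.1 Lemma 2.6.1
  (the orthogonal-basis trace computation, tree file `PositiveInvolutionRegularTrace.lean`).
-/

noncomputable section

open Module

namespace Literature.RingTheory.CentralSimple

open Literature.NumberTheory.Automorphic (leftMulTrace leftMulTrace_apply)

universe u v w

variable {D : Type u} [Ring D] [Algebra ℚ D]

/-! ## §1 Condition (14): positive-definite symmetric invariant forms -/

section Forms

/-- **Condition (14) of Prop. 1.37**: the `B`-module `V` «admits a positive definite symmetric `ℚ`-bilinear form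
`( | ) : V × V → ℚ` such that `(bu|v) = (u|b'v)`, all `b ∈ B`, `u, v ∈ V`».
[cite: MilneCM2006, Ch. I §1 Prop. 1.37 (14) (p. 20)] -/
def HasInvariantPosDefForm (ι : D →ₗ[ℚ] D) (V : Type v) [AddCommGroup V] [Module ℚ V] [Module D V] : Prop :=
  ∃ β : LinearMap.BilinForm ℚ V,
    (∀ u v, β u v = β v u) ∧ (∀ v, v ≠ 0 → 0 < β v v) ∧ ∀ (b : D) (u v : V), β (b • u) v = β u (ι b • v)

variable {ι : D →ₗ[ℚ] D}
variable {V : Type v} [AddCommGroup V] [Module ℚ V] [Module D V] [IsScalarTower ℚ D V]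
variable {W : Type w} [AddCommGroup W] [Module ℚ W] [Module D W] [IsScalarTower ℚ D W]

/-- The orthogonal sum `⊕ₖ ( | )` on `Vⁿ` of a form on `V`. [cite: MilneCM2006, Ch. I §1 Prop. 1.37 (proof, (a)⟹(b))] -/
def piForm (β : LinearMap.BilinForm ℚ V) (n : ℕ) : LinearMap.BilinForm ℚ (Fin n → V) :=
  ∑ k : Fin n, β.compl₁₂ (LinearMap.proj k) (LinearMap.proj k)

omit [Module D V] [IsScalarTower ℚ D V] in
/-- `(⊕ₖ β)(u, v) = Σₖ β(uₖ, vₖ)`. [cite: MilneCM2006, Ch. I §1 Prop. 1.37 (proof, (a)⟹(b))] -/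
@[simp]
theorem piForm_apply (β : LinearMap.BilinForm ℚ V) (n : ℕ) (u v : Fin n → V) :
    piForm β n u v = ∑ k, β (u k) (v k) := by
  simp [piForm, LinearMap.sum_apply]

omit [IsScalarTower ℚ D V] in
/-- **Forms (14) pass to finite direct sums** `Vⁿ` («a direct sum of copies of `V`»).
[cite: MilneCM2006, Ch. I §1 Prop. 1.37 (proof, (a)⟹(b))] -/
theorem HasInvariantPosDefForm.pi (hV : HasInvariantPosDefForm ι V) (n : ℕ) :
    HasInvariantPosDefForm ι (Fin n → V) := by
  obtain ⟨β, hsymm, hpos, h14⟩ := hV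
  refine ⟨piForm β n, fun u v ↦ ?_, fun v hv ↦ ?_, fun b u v ↦ ?_⟩
  · rw [piForm_apply, piForm_apply]
    exact Finset.sum_congr rfl fun k _ ↦ hsymm _ _
  · rw [piForm_apply]
    obtain ⟨k, hk⟩ : ∃ k, v k ≠ 0 := by
      by_contra hall
      push Not at hall
      exact hv (funext hall)
    refine Finset.sum_pos' (fun j _ ↦ ?_) ⟨k, Finset.mem_univ k, hpos _ hk⟩
    by_cases hj : v j = 0
    · rw [hj]
      simp
    · exact (hpos _ hj).le
  · rw [piForm_apply, piForm_apply]
    exact Finset.sum_congr rfl fun k _ ↦ by rw [Pi.smul_apply, Pi.smul_apply, h14]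

/-- **Forms (14) restrict along injective `B`-linear maps** («the restriction of a bilinear form as in (a) to a
`B`-submodule is of the same type»). [cite: MilneCM2006, Ch. I §1 Prop. 1.37 (proof, (a)⟹(b))] -/
theorem HasInvariantPosDefForm.comap (hV : HasInvariantPosDefForm ι V) (e : W →ₗ[D] V)
    (he : Function.Injective e) : HasInvariantPosDefForm ι W := by
  obtain ⟨β, hsymm, hpos, h14⟩ := hV
  refine ⟨β.compl₁₂ (e.restrictScalars ℚ) (e.restrictScalars ℚ), fun u v ↦ hsymm _ _, fun v hv ↦ ?_,
    fun b u v ↦ ?_⟩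
  · exact hpos _ fun h0 ↦ hv (he (by rw [map_zero]; exact h0))
  · simp only [LinearMap.compl₁₂_apply, LinearMap.coe_restrictScalars, map_smul, h14]

end Forms

/-! ## §2 Embeddings: `B ↪ Vᵐ` for a faithful `V`, and `W ↪ Bᵐ` over a semisimple `B` -/

section Embeddings

variable {V : Type v} [AddCommGroup V] [Module ℚ V] [Module D V] [IsScalarTower ℚ D V]

omit [Algebra ℚ D] [IsScalarTower ℚ D V] in
/-- **A faithful finite-dimensional `B`-module contains a copy of `B` in a finite sum**: for a `ℚ`-basis `(vₖ)` of
`V`, `b ↦ (b vₖ)ₖ : B → Vᵐ` is `B`-linear and injective (`b vₖ = 0` for all `k` forces `b V = 0`, so `b = 0`).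
This replaces the printed «every `B`-module is a direct summand of a direct sum of copies of `V`» for the module
`B` itself. [cite: MilneCM2006, Ch. I §1 Prop. 1.37 (proof, (a)⟹(b), and p. 8)] -/
theorem exists_injective_linearMap_pi_of_faithfulSMul [Module.Finite ℚ V] [FaithfulSMul D V] :
    ∃ (n : ℕ) (e : D →ₗ[D] (Fin n → V)), Function.Injective e := by
  let w := Module.finBasis ℚ V
  refine ⟨Module.finrank ℚ V,
    { toFun := fun b k ↦ b • w k
      map_add' := fun b c ↦ funext fun k ↦ add_smul b c (w k)
      map_smul' := fun a b ↦ funext fun k ↦ mul_smul a b (w k) }, fun b c hbc ↦ ?_⟩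
  refine FaithfulSMul.eq_of_smul_eq_smul (α := V) fun x ↦ ?_
  have hk : ∀ k, b • w k = c • w k := fun k ↦ congrFun hbc k
  rw [← w.sum_repr x, Finset.smul_sum, Finset.smul_sum]
  exact Finset.sum_congr rfl fun k _ ↦ by rw [smul_comm b, smul_comm c, hk]

omit [Algebra ℚ D] in
/-- **Every finitely generated module over a semisimple `B` embeds in some `Bᵐ`** (it is a direct summand: a
complement of the kernel of a surjection `Bᵐ ↠ W`; «every such module is semisimple», p. 8).
[cite: MilneCM2006, Ch. I §1 p. 8 (modules over a semisimple algebra) and Prop. 1.37 (proof)] -/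
theorem exists_injective_linearMap_pi_of_isSemisimpleRing [IsSemisimpleRing D] (W : Type w) [AddCommGroup W]
    [Module D W] [Module.Finite D W] :
    ∃ (n : ℕ) (e : W →ₗ[D] (Fin n → D)), Function.Injective e := by
  obtain ⟨n, f, hf⟩ := Module.Finite.exists_fin' D W
  obtain ⟨C, hC⟩ := exists_isCompl (LinearMap.ker f)
  let g : W ≃ₗ[D] C := (f.quotKerEquivOfSurjective hf).symm.trans (Submodule.quotientEquivOfIsCompl _ C hC)
  exact ⟨n, C.subtype.comp g.toLinearMap, fun x y hxy ↦ g.injective (Subtype.ext hxy)⟩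

end Embeddings

/-! ## §3 (a) ⟹ (c): a form (14) on a faithful module makes `'` positive -/

section AtoC

variable {ι : D →ₗ[ℚ] D}

/-- **(a) ⟹ (c) for `V = B`** (the printed step (b)⟹(c) «with `W = B`»): if `B` itself carries a positive
definite symmetric form with `(bu|v) = (u|b'v)`, then `Tr_{B/ℚ}(b'b) > 0` for `b ≠ 0` — in an orthogonal basis
`(eᵢ)`, `Tr(L_{b'b}) = Σᵢ (b'b eᵢ|eᵢ)/(eᵢ|eᵢ) = Σᵢ (b eᵢ|b eᵢ)/(eᵢ|eᵢ) > 0` unless every `b eᵢ = 0`, i.e. `b = 0`.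
[cite: MilneCM2006, Ch. I §1 Prop. 1.37 (proof, (b)⟹(c)) (p. 20)] -/
theorem IsAntiInvolution.isPositiveAntiInvolution_of_hasInvariantPosDefForm_self [Module.Finite ℚ D]
    (hι : IsAntiInvolution D ι) (hD : HasInvariantPosDefForm ι D) : IsPositiveAntiInvolution D ι := by
  classical
  obtain ⟨β, hsymm, hpos, h14⟩ := hD
  refine ⟨hι, fun x hx ↦ ?_⟩
  have hβsymm : LinearMap.IsSymm β := ⟨fun u v ↦ hsymm u v⟩
  haveI : Invertible (2 : ℚ) := invertibleOfNonzero two_ne_zero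
  obtain ⟨b, hb⟩ := LinearMap.BilinForm.exists_orthogonal_basis hβsymm
  have hq : ∀ i, 0 < β (b i) (b i) := fun i ↦ hpos _ (b.ne_zero i)
  have hd : ∀ i, β (b i) (b i) ≠ 0 := fun i ↦ (hq i).ne'
  rw [leftMulTrace_apply, trace_eq_sum_div_of_isOrthoᵢ b hb hd]
  -- every term is `(x eᵢ | x eᵢ)/(eᵢ|eᵢ) ≥ 0`
  have hterm : ∀ i, β (Algebra.lmul ℚ D (ι x * x) (b i)) (b i) / β (b i) (b i) =
      β (x * b i) (x * b i) / β (b i) (b i) := by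
    intro i
    rw [Algebra.coe_lmul_eq_mul, LinearMap.mul_apply', mul_assoc, ← smul_eq_mul (a := ι x), h14,
      hι.apply_apply, smul_eq_mul]
  simp_rw [hterm]
  -- some `x eᵢ ≠ 0`, since `x = x · 1 = Σ cᵢ x eᵢ`
  obtain ⟨i, hi⟩ : ∃ i, x * b i ≠ 0 := by
    by_contra! h
    apply hx
    calc x = x * ∑ i, b.repr 1 i • b i := by rw [b.sum_repr, mul_one]
      _ = ∑ i, b.repr 1 i • (x * b i) := by rw [Finset.mul_sum]; simp_rw [mul_smul_comm]
      _ = 0 := by simp [h]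
  refine Finset.sum_pos' (fun j _ ↦ ?_) ⟨i, Finset.mem_univ i, div_pos (hpos _ hi) (hq i)⟩
  by_cases hj : x * b j = 0
  · rw [hj, LinearMap.BilinForm.zero_left, zero_div]
  · exact (div_pos (hpos _ hj) (hq j)).le

variable {V : Type v} [AddCommGroup V] [Module ℚ V] [Module D V] [IsScalarTower ℚ D V]

omit [IsScalarTower ℚ D V] in
/-- **(a) ⟹ (c)**: if some FAITHFUL finite-dimensional `B`-module `V` admits a positive definite symmetric form
with `(bu|v) = (u|b'v)`, then `'` is positive — transport the form to `B ⊆ Vᵐ` and apply the case `V = B`.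
(The semisimplicity half of (a) is not used; it then follows from (c) by Prop. 1.36.)
[cite: MilneCM2006, Ch. I §1 Prop. 1.37 ((a)⟹(b)⟹(c)) (p. 20)] -/
theorem IsAntiInvolution.isPositiveAntiInvolution_of_hasInvariantPosDefForm [Module.Finite ℚ D]
    (hι : IsAntiInvolution D ι) [Module.Finite ℚ V] [FaithfulSMul D V] (hV : HasInvariantPosDefForm ι V) :
    IsPositiveAntiInvolution D ι := by
  obtain ⟨n, e, he⟩ := exists_injective_linearMap_pi_of_faithfulSMul (D := D) (V := V)
  exact hι.isPositiveAntiInvolution_of_hasInvariantPosDefForm_self ((hV.pi n).comap e he)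

end AtoC

/-! ## §4 (c) ⟹ (a), (c) ⟹ (b) -/

section CtoAB

variable {ι : D →ₗ[ℚ] D}

/-- **(c) ⟹ (a), the form on `V = B`**: for a positive `'` the form `(u|v) = Tr_{B/ℚ}(u'v) + Tr_{B/ℚ}(v'u)` on `B`
is symmetric, positive definite (`(u|u) = 2 Tr(u'u) > 0`) and satisfies `(bu|v) = (u|b'v)` (printed witness:
`Tr_{B/ℚ}(uv')`, here symmetrised). [cite: MilneCM2006, Ch. I §1 Prop. 1.37 ((c)⟹(a)) (p. 20)] -/
theorem IsPositiveAntiInvolution.hasInvariantPosDefForm_self (h : IsPositiveAntiInvolution D ι) :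
    HasInvariantPosDefForm ι D := by
  let τ : D →ₗ[ℚ] ℚ := leftMulTrace ℚ D
  refine ⟨involutionTraceForm ι τ + (involutionTraceForm ι τ).flip, fun u v ↦ ?_, fun v hv ↦ ?_,
    fun b u v ↦ ?_⟩
  · simp only [LinearMap.add_apply, LinearMap.BilinForm.flip_apply, involutionTraceForm_apply]
    rw [add_comm]
  · simp only [LinearMap.add_apply, LinearMap.BilinForm.flip_apply, involutionTraceForm_apply]
    exact add_pos (h.trace_pos v hv) (h.trace_pos v hv)
  · simp only [LinearMap.add_apply, LinearMap.BilinForm.flip_apply, involutionTraceForm_apply, smul_eq_mul]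
    rw [h.map_mul, h.map_mul, h.apply_apply]
    simp only [mul_assoc]

/-- **(c) ⟹ (a)** verbatim: a positive `'` makes `B` semisimple (Prop. 1.36) and the faithful module `V = B` admits
a form (14). [cite: MilneCM2006, Ch. I §1 Prop. 1.37 ((c)⟹(a)) (p. 20)] -/
theorem IsPositiveAntiInvolution.isSemisimpleRing_and_hasInvariantPosDefForm_self [Module.Finite ℚ D]
    (h : IsPositiveAntiInvolution D ι) : IsSemisimpleRing D ∧ HasInvariantPosDefForm ι D :=
  ⟨h.isSemisimpleRing, h.hasInvariantPosDefForm_self⟩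

variable {W : Type w} [AddCommGroup W] [Module ℚ W] [Module D W] [IsScalarTower ℚ D W]

/-- **(c) ⟹ (b)**: for a positive `'`, EVERY finite-dimensional `B`-module `W` admits a positive definite symmetric
form with `(bu|v) = (u|b'v)` — `B` is semisimple (Prop. 1.36), so `W` embeds in some `Bᵐ` as a direct summand, and
the restriction of `⊕ (Tr(u'v) + Tr(v'u))` is of the same type.
[cite: MilneCM2006, Ch. I §1 Prop. 1.37 ((c)⟹(a)⟹(b)) (p. 20)] -/
theorem IsPositiveAntiInvolution.hasInvariantPosDefForm [Module.Finite ℚ D] (h : IsPositiveAntiInvolution D ι)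
    (W : Type w) [AddCommGroup W] [Module ℚ W] [Module D W] [IsScalarTower ℚ D W] [Module.Finite ℚ W] :
    HasInvariantPosDefForm ι W := by
  haveI := h.isSemisimpleRing
  haveI : Module.Finite D W := Module.Finite.of_restrictScalars_finite ℚ D W
  obtain ⟨n, e, he⟩ := exists_injective_linearMap_pi_of_isSemisimpleRing (D := D) W
  exact (h.hasInvariantPosDefForm_self.pi n).comap e he

end CtoAB

/-! ## §5 Proposition 1.37 as equivalences -/

section Prop137

variable {ι : D →ₗ[ℚ] D} [Module.Finite ℚ D]

/-- **PROP. 1.37, (c) ⟺ (a) with `V = B`**: `'` is positive iff `B` admits a positive definite symmetric form with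
`(bu|v) = (u|b'v)` (and then `B` is semisimple, `IsPositiveAntiInvolution.isSemisimpleRing`).
[cite: MilneCM2006, Ch. I §1 Prop. 1.37 (p. 20)] -/
theorem IsAntiInvolution.isPositiveAntiInvolution_iff_hasInvariantPosDefForm_self (hι : IsAntiInvolution D ι) :
    IsPositiveAntiInvolution D ι ↔ HasInvariantPosDefForm ι D :=
  ⟨fun h ↦ h.hasInvariantPosDefForm_self, fun hD ↦ hι.isPositiveAntiInvolution_of_hasInvariantPosDefForm_self hD⟩

/-- **PROP. 1.37, (c) ⟺ (b)**: `'` is positive iff EVERY finite-dimensional `B`-module admits a positive definite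
symmetric form with `(bu|v) = (u|b'v)` (modules in the universe of `B`, which contains `W = B`).
[cite: MilneCM2006, Ch. I §1 Prop. 1.37 (p. 20)] -/
theorem IsAntiInvolution.isPositiveAntiInvolution_iff_forall_hasInvariantPosDefForm (hι : IsAntiInvolution D ι) :
    IsPositiveAntiInvolution D ι ↔
      ∀ (W : Type u) [AddCommGroup W] [Module ℚ W] [Module D W] [IsScalarTower ℚ D W] [Module.Finite ℚ W],
        HasInvariantPosDefForm ι W :=
  ⟨fun h W _ _ _ _ _ ↦ h.hasInvariantPosDefForm W,
    fun hall ↦ hι.isPositiveAntiInvolution_of_hasInvariantPosDefForm_self (hall D)⟩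

/-- **PROP. 1.37, (c) ⟺ (a)**: `'` is positive iff `B` is semisimple and SOME faithful finite-dimensional `B`-module
admits a positive definite symmetric form with `(bu|v) = (u|b'v)` (modules in the universe of `B`).
[cite: MilneCM2006, Ch. I §1 Prop. 1.37 (p. 20)] -/
theorem IsAntiInvolution.isPositiveAntiInvolution_iff_exists_faithful (hι : IsAntiInvolution D ι) :
    IsPositiveAntiInvolution D ι ↔ IsSemisimpleRing D ∧
      ∃ (V : Type u) (_ : AddCommGroup V) (_ : Module ℚ V) (_ : Module D V) (_ : IsScalarTower ℚ D V)
        (_ : Module.Finite ℚ V) (_ : FaithfulSMul D V), HasInvariantPosDefForm ι V := by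
  refine ⟨fun h ↦ ⟨h.isSemisimpleRing, D, inferInstance, inferInstance, inferInstance, inferInstance,
    inferInstance, inferInstance, h.hasInvariantPosDefForm_self⟩, ?_⟩
  rintro ⟨-, V, _, _, _, _, _, _, hV⟩
  exact hι.isPositiveAntiInvolution_of_hasInvariantPosDefForm hV

end Prop137

/-! ## §6 Validation -/

section Validation

/-- `(ℚ, id)`: the form `(u|v) = 2uv` witnesses (14) on the faithful module `ℚ`. [cite: MilneCM2006, Ch. I §1 Example 1.38 (a), Prop. 1.37] -/
theorem hasInvariantPosDefForm_rat : HasInvariantPosDefForm (LinearMap.id : ℚ →ₗ[ℚ] ℚ) ℚ :=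
  (isAlbertTypeI_rat.2).hasInvariantPosDefForm_self

/-- On `ℚ × ℚ` the swap `(a, b) ↦ (b, a)` is an (anti-)involution which is NOT positive — «case (b)» of the proof of
Prop. 1.39: `Tr((1,0)'(1,0)) = Tr((0,1)(1,0)) = 0` —, hence by Prop. 1.37 NO `ℚ × ℚ`-module that is faithful carries
a positive definite symmetric form with `(bu|v) = (u|b'v)` for the swap.
[cite: MilneCM2006, Ch. I §1 Prop. 1.37 and Prop. 1.39 (proof, footnote 11) (p. 20–21)] -/
theorem not_hasInvariantPosDefForm_swap :
    ¬ HasInvariantPosDefForm (LinearEquiv.prodComm ℚ ℚ ℚ : ℚ × ℚ →ₗ[ℚ] ℚ × ℚ) (ℚ × ℚ) := by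
  have hι : IsAntiInvolution (ℚ × ℚ) (LinearEquiv.prodComm ℚ ℚ ℚ : ℚ × ℚ →ₗ[ℚ] ℚ × ℚ) :=
    ⟨fun x y ↦ by ext <;> simp [mul_comm], fun x ↦ by simp⟩
  intro h
  have hpos := (hι.isPositiveAntiInvolution_of_hasInvariantPosDefForm_self h).eq_zero_of_apply_mul_self
    (a := ((1 : ℚ), (0 : ℚ))) (by simp)
  simp at hpos

end Validation

end Literature.RingTheory.CentralSimple

end
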